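import Summits.AtomisticToContinuum.BoseEinsteinCondensation.Theses.BECHusimiAmplitudeGas
import Literature.MathematicalPhysics.QuantumManyBody.TorusFockSectorDictionary
import Literature.MathematicalPhysics.QuantumManyBody.WeightedCorrector

/-!
# Husimi concentration, I: the degree-`N` form `F(u_c)` as an antiholomorphic polynomial

Part of the proof, for route `BECHusimiAmplitudeGas` of `AtomisticToContinuum/BoseEinsteinCondensation`,
that the Laplace-principle node `HusimiConcentration` (item stmt-AtomisticToContinuum-11994) follows
from the two cap estimates `PhaseCapDecay` (stmt-11990) and `AmplitudeLDP` (stmt-11991) — the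
content of the glue item `LaplaceCapUnion` (stmt-11995). Setting (generic over a finite index type
`ι` of modes with an injective labelling `m : ι → ℤ³`, `m i₀ = 0`): scaled plane waves
`e_i = e_{m i}/√L³` on the cell `[0,L)³`, `u_c = ∑ᵢ cᵢ eᵢ` for `c : ι → ℂ`, the degree-`N` form
`F(g) = ∫_{cell^N} ∏ⱼ conj g(xⱼ) Ψ(X) dX`, the Gaussian weight `w(c) = e^{-∑|cᵢ|²}` on
`ι → ℂ ≅ ℝ^{2|ι|}` (Lebesgue measure), and the word integrals
`J_k = ∫_{cell^N} ∏ⱼ conj e_{kⱼ}(xⱼ) Ψ` for words `k : Fin N → ι`.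

This file: the word expansion `F(u_c) = ∑_k conj(∏ⱼ c_{kⱼ}) J_k` (`form_eq_sum`) and its
consequences — continuity in `c`, real homogeneity `F(u_{tc}) = tᴺ F(u_c)`, the effect of a phase
rotation of one coordinate, the overlap `⟨u_c, φ₀⟩ = conj c_{i₀}` (plane-wave orthogonality on the
cell), the identification of the pure-condensate coefficient `F(φ₀) = J_{k₀} = (√L³)^{-N}∫Ψ`,
the positivity improvement `|F(g)| ≤ F(|g|)` for `Ψ ≥ 0`, and the polynomial growth bound
`|F(u_c)| ≤ K (∑|cᵢ|)ᴺ`. Everything is elementary bookkeeping with finite sums and Bochner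
integrals over the bounded cell (no named facts). Sources: the route thesis (planner), Bargmann /
lower-symbol calculus as in Chiribella 2011 (arXiv:1010.1875) and Rougerie 2014 (arXiv:1409.1182).
-/

noncomputable section

namespace Summit.AtomisticToContinuum.BoseEinsteinCondensation.Theorems

open MeasureTheory
open scoped ENNReal NNReal ComplexConjugate BigOperators
open Literature.MathematicalPhysics.QuantumManyBody.BoseGas

namespace HusimiConcentration

variable {ι : Type*} [Fintype ι] {N : ℕ} {L : ℝ}


/-- **Word expansion** of a product of linear combinations:
`∏ⱼ conj(∑ᵢ cᵢ wᵢ(xⱼ)) = ∑_{k : Fin N → ι} conj(∏ⱼ c_{k j}) ∏ⱼ conj(w_{k j}(xⱼ))`. [folklore] -/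
theorem prod_conj_sum_mul (c : ι → ℂ) (w : ι → Space → ℂ) (X : Config N) :
    ∏ j, conj (∑ i, c i * w i (X j)) =
      ∑ k : Fin N → ι, conj (∏ j, c (k j)) * ∏ j, conj (w (k j) (X j)) := by
  classical
  simp only [map_sum, map_mul]
  rw [Finset.prod_univ_sum]
  simp only [Fintype.piFinset_univ]
  refine Finset.sum_congr rfl fun k _ => ?_
  rw [Finset.prod_mul_distrib, map_prod]

omit [Fintype ι] in
/-- The scaled plane-wave products `X ↦ (∏ⱼ conj(e_{m(kⱼ)}(xⱼ)/√L³)) Ψ(X)` are continuous for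
continuous `Ψ`. [folklore] -/
theorem continuous_prod_conj_cellWave_mul (m : ι → (Fin 3 → ℤ)) (k : Fin N → ι) {Ψ : Config N → ℂ}
    (hΨ : Continuous Ψ) :
    Continuous fun X : Config N =>
      (∏ j, conj (cellWave L (m (k j)) (X j) / (Real.sqrt (L ^ 3) : ℂ))) * Ψ X := by
  refine Continuous.mul (continuous_finsetProd _ fun j _ => ?_) hΨ
  have h : Continuous fun X : Config N => cellWave L (m (k j)) (X j) / (Real.sqrt (L ^ 3) : ℂ) :=
    ((continuous_cellWave L _).comp (continuous_apply j)).div_const _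
  exact Complex.continuous_conj.comp h

/-- **The Husimi form is an antiholomorphic polynomial in the coefficients**:
`F(u_c) = ∑_{k : Fin N → ι} conj(∏ⱼ c_{kⱼ}) · J_k` with the word integrals
`J_k = ∫_{cell^N} ∏ⱼ conj(e_{m(kⱼ)}(xⱼ)/√L³) Ψ`. [folklore] -/
theorem form_eq_sum (m : ι → (Fin 3 → ℤ)) {Ψ : Config N → ℂ} (hΨ : Continuous Ψ) (c : ι → ℂ) :
    ∫ X in cellN N L, (∏ j, conj (∑ i, c i * (cellWave L (m i) (X j) / (Real.sqrt (L ^ 3) : ℂ)))) * Ψ X =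
      ∑ k : Fin N → ι, conj (∏ j, c (k j)) *
        ∫ X in cellN N L, (∏ j, conj (cellWave L (m (k j)) (X j) / (Real.sqrt (L ^ 3) : ℂ))) * Ψ X := by
  have hpt : ∀ X : Config N,
      (∏ j, conj (∑ i, c i * (cellWave L (m i) (X j) / (Real.sqrt (L ^ 3) : ℂ)))) * Ψ X =
      ∑ k : Fin N → ι, conj (∏ j, c (k j)) *
        ((∏ j, conj (cellWave L (m (k j)) (X j) / (Real.sqrt (L ^ 3) : ℂ))) * Ψ X) := by
    intro X
    rw [prod_conj_sum_mul c (fun i x => cellWave L (m i) x / (Real.sqrt (L ^ 3) : ℂ)) X,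
      Finset.sum_mul]
    refine Finset.sum_congr rfl fun k _ => ?_
    rw [mul_assoc]
  simp_rw [hpt]
  rw [integral_finsetSum _ fun k _ => ?_]
  · refine Finset.sum_congr rfl fun k _ => ?_
    rw [integral_const_mul]
  · exact (integrableOn_cellN (continuous_prod_conj_cellWave_mul m k hΨ) L).integrable.const_mul _

/-- `c ↦ F(u_c)` is continuous (a polynomial in `conj c`). [folklore] -/
theorem continuous_form (m : ι → (Fin 3 → ℤ)) {Ψ : Config N → ℂ} (hΨ : Continuous Ψ) :
    Continuous fun c : ι → ℂ =>
      ∫ X in cellN N L, (∏ j, conj (∑ i, c i * (cellWave L (m i) (X j) / (Real.sqrt (L ^ 3) : ℂ)))) * Ψ X := by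
  simp_rw [form_eq_sum m hΨ]
  refine continuous_finsetSum _ fun k _ => ?_
  refine Continuous.mul ?_ continuous_const
  exact Complex.continuous_conj.comp (continuous_finsetProd _ fun j _ => continuous_apply _)

/-- **Real homogeneity**: `F(u_{tc}) = t^N F(u_c)` for real `t`. [folklore] -/
theorem form_smul (m : ι → (Fin 3 → ℤ)) {Ψ : Config N → ℂ} (hΨ : Continuous Ψ) (t : ℝ) (c : ι → ℂ) :
    ∫ X in cellN N L, (∏ j, conj (∑ i, (t • c) i * (cellWave L (m i) (X j) / (Real.sqrt (L ^ 3) : ℂ)))) * Ψ X =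
      (t : ℂ) ^ N *
      ∫ X in cellN N L, (∏ j, conj (∑ i, c i * (cellWave L (m i) (X j) / (Real.sqrt (L ^ 3) : ℂ)))) * Ψ X := by
  rw [form_eq_sum m hΨ, form_eq_sum m hΨ, Finset.mul_sum]
  refine Finset.sum_congr rfl fun k _ => ?_
  rw [← mul_assoc]
  congr 1
  simp only [Pi.smul_apply, Complex.real_smul, Finset.prod_mul_distrib, Finset.prod_const,
    Finset.card_univ, Fintype.card_fin, map_mul, map_pow, Complex.conj_ofReal]

/-- **Phase rotation of one coordinate**: with `(R_a c)ᵢ = a cᵢ` for `i = i₀` and `cᵢ` otherwise,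
`F(u_{R_a c}) = ∑_k conj(a)^{#{j | kⱼ = i₀}} conj(∏ⱼ c_{kⱼ}) J_k`. [folklore] -/
theorem form_rotate [DecidableEq ι] (m : ι → (Fin 3 → ℤ)) {Ψ : Config N → ℂ} (hΨ : Continuous Ψ) (i₀ : ι) (a : ℂ)
    (c : ι → ℂ) :
    ∫ X in cellN N L, (∏ j, conj (∑ i, (fun i => if i = i₀ then a * c i else c i) i *
        (cellWave L (m i) (X j) / (Real.sqrt (L ^ 3) : ℂ)))) * Ψ X =
      ∑ k : Fin N → ι, conj a ^ (Finset.univ.filter fun j => k j = i₀).card * conj (∏ j, c (k j)) *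
        ∫ X in cellN N L, (∏ j, conj (cellWave L (m (k j)) (X j) / (Real.sqrt (L ^ 3) : ℂ))) * Ψ X := by
  rw [form_eq_sum m hΨ]
  refine Finset.sum_congr rfl fun k _ => ?_
  congr 1
  rw [← map_pow, ← map_mul]
  congr 1
  rw [Finset.prod_ite, Finset.prod_mul_distrib, Finset.prod_const, mul_assoc,
    ← Finset.prod_union (Finset.disjoint_filter_filter_not _ _ _),
    Finset.filter_union_filter_not_eq]


/-- **Overlap with the constant mode**: `⟨u_c, φ₀⟩_{cell} = conj(c_{i₀})` when the labelling `m`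
is injective and `m i₀ = 0` (orthogonality of the plane waves on the cell). [folklore] -/
theorem ov_sum (hL : 0 < L) (m : ι → (Fin 3 → ℤ)) (hm : Function.Injective m) (i₀ : ι)
    (hi₀ : m i₀ = 0) (c : ι → ℂ) :
    ∫ x in cell L, conj (∑ i, c i * (cellWave L (m i) x / (Real.sqrt (L ^ 3) : ℂ))) *
        constantMode L x = conj (c i₀) := by
  have hL3 : (0 : ℝ) < L ^ 3 := by positivity
  have hs : (Real.sqrt (L ^ 3) : ℂ) ≠ 0 := by
    exact_mod_cast (Real.sqrt_pos.2 hL3).ne'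
  -- replace the indicator by the constant on the cell
  have hcongr : ∀ x ∈ cell L,
      conj (∑ i, c i * (cellWave L (m i) x / (Real.sqrt (L ^ 3) : ℂ))) * constantMode L x =
      ∑ i, conj (c i) * ((Real.sqrt (L ^ 3) : ℂ) ^ 2)⁻¹ * cellWave L (-m i) x := by
    intro x hx
    rw [constantMode, Set.indicator_of_mem hx, map_sum, Finset.sum_mul]
    refine Finset.sum_congr rfl fun i _ => ?_
    rw [map_mul, map_div₀, conj_cellWave, Complex.conj_ofReal]
    field_simp
  rw [setIntegral_congr_fun (measurableSet_cell L) hcongr,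
    integral_finsetSum _ fun i _ => ?_]
  · simp_rw [integral_const_mul, integral_cell_cellWave hL, neg_eq_zero]
    rw [Finset.sum_eq_single i₀]
    · rw [if_pos hi₀]
      have h2 : ((Real.sqrt (L ^ 3) : ℂ) ^ 2) = (L : ℂ) ^ 3 := by
        rw [← Complex.ofReal_pow, Real.sq_sqrt hL3.le]; push_cast; ring
      rw [h2, mul_assoc, inv_mul_cancel₀ (by exact_mod_cast hL3.ne'), mul_one]
    · intro i _ hi
      rw [if_neg (fun h => hi (hm (h.trans hi₀.symm))), mul_zero]
    · intro h; exact absurd (Finset.mem_univ i₀) h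
  · exact ((integrableOn_cell (continuous_cellWave L _)).integrable.const_mul _)

omit [Fintype ι] in
/-- **The pure-condensate coefficient**: on the cell the constant mode is the scaled plane wave
`e_0/√L³`, so `F(φ₀) = J_{k₀}` for the constant word `k₀ ≡ i₀` (`m i₀ = 0`). [folklore] -/
theorem form_constantMode (m : ι → (Fin 3 → ℤ)) (i₀ : ι) (hi₀ : m i₀ = 0) (Ψ : Config N → ℂ) :
    ∫ X in cellN N L, (∏ j, conj (constantMode L (X j))) * Ψ X =
      ∫ X in cellN N L, (∏ j : Fin N, conj (cellWave L (m i₀) (X j) / (Real.sqrt (L ^ 3) : ℂ))) * Ψ X := by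
  refine setIntegral_congr_fun (measurableSet_cellN N L) fun X hX => ?_
  congr 1
  refine Finset.prod_congr rfl fun j _ => ?_
  rw [constantMode, Set.indicator_of_mem (hX j), hi₀, cellWave_zero, one_div]

/-- **Evaluation at the constant direction**: `F(u_{δ_{i₀}}) = J_{k₀}`. [folklore] -/
theorem form_single [DecidableEq ι] (m : ι → (Fin 3 → ℤ)) {Ψ : Config N → ℂ} (hΨ : Continuous Ψ)
    (i₀ : ι) :
    ∫ X in cellN N L, (∏ j, conj (∑ i, (Pi.single i₀ (1 : ℂ) : ι → ℂ) i *
        (cellWave L (m i) (X j) / (Real.sqrt (L ^ 3) : ℂ)))) * Ψ X =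
      ∫ X in cellN N L, (∏ j : Fin N, conj (cellWave L (m i₀) (X j) / (Real.sqrt (L ^ 3) : ℂ))) * Ψ X := by
  rw [form_eq_sum m hΨ, Finset.sum_eq_single (fun _ => i₀)]
  · simp
  · intro k _ hk
    have : ∃ j, k j ≠ i₀ := by
      by_contra h
      push Not at h
      exact hk (funext h)
    obtain ⟨j, hj⟩ := this
    rw [Finset.prod_eq_zero (Finset.mem_univ j) (by simp [hj]), map_zero, zero_mul]
  · intro h; exact absurd (Finset.mem_univ _) h

omit [Fintype ι] in
/-- `J_{k₀} = (√L³)^{-N} ∫_{cell^N} Ψ` for the constant word (`m i₀ = 0`). [folklore] -/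
theorem wordIntegral_const (m : ι → (Fin 3 → ℤ)) (i₀ : ι) (hi₀ : m i₀ = 0) (Ψ : Config N → ℂ) :
    ∫ X in cellN N L, (∏ j : Fin N, conj (cellWave L (m i₀) (X j) / (Real.sqrt (L ^ 3) : ℂ))) * Ψ X =
      (((Real.sqrt (L ^ 3))⁻¹ ^ N : ℝ) : ℂ) * ∫ X in cellN N L, Ψ X := by
  rw [← integral_const_mul]
  refine setIntegral_congr_fun (measurableSet_cellN N L) fun X _ => ?_
  simp [hi₀, cellWave_zero]

/-- **Positivity improves the modulus**: for `Ψ ≥ 0` pointwise,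
`|F(g)| ≤ |F(|g|)|` (`|∫ ∏conj g(xⱼ) Ψ| ≤ ∫ ∏|g(xⱼ)| Ψ = F(|g|)`). [folklore] -/
theorem norm_form_le_form_abs {Ψ : Config N → ℂ} (hΨ : ∀ X, Ψ X = ((‖Ψ X‖ : ℝ) : ℂ))
    (g : Space → ℂ) :
    ‖∫ X in cellN N L, (∏ j, conj (g (X j))) * Ψ X‖ ≤
      ‖∫ X in cellN N L, (∏ j, conj ((‖g (X j)‖ : ℝ) : ℂ)) * Ψ X‖ := by
  have hpt : ∀ X : Config N, (∏ j, conj (((‖g (X j)‖ : ℝ) : ℂ))) * Ψ X =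
      (((∏ j, ‖g (X j)‖) * ‖Ψ X‖ : ℝ) : ℂ) := by
    intro X
    rw [hΨ X]
    push_cast
    simp only [Complex.conj_ofReal, Complex.norm_real, norm_norm]
  simp_rw [hpt]
  rw [integral_complex_ofReal, Complex.norm_real, Real.norm_of_nonneg
    (integral_nonneg fun X => by positivity)]
  refine (norm_integral_le_integral_norm _).trans (le_of_eq ?_)
  refine integral_congr_ae (Filter.Eventually.of_forall fun X => ?_)
  simp only [norm_mul, norm_prod, Complex.norm_conj]

/-- **Polynomial growth**: `|F(u_c)| ≤ K (∑ᵢ |cᵢ|)^N` with `K = ∑_k |J_k|`. [folklore] -/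
theorem norm_form_le (m : ι → (Fin 3 → ℤ)) {Ψ : Config N → ℂ} (hΨ : Continuous Ψ) (c : ι → ℂ) :
    ‖∫ X in cellN N L, (∏ j, conj (∑ i, c i * (cellWave L (m i) (X j) / (Real.sqrt (L ^ 3) : ℂ)))) * Ψ X‖ ≤
      (∑ k : Fin N → ι,
        ‖∫ X in cellN N L, (∏ j, conj (cellWave L (m (k j)) (X j) / (Real.sqrt (L ^ 3) : ℂ))) * Ψ X‖) *
      (∑ i, ‖c i‖) ^ N := by
  classical
  have hexp : (∑ i, ‖c i‖) ^ N = ∑ k : Fin N → ι, ∏ j, ‖c (k j)‖ := by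
    calc (∑ i, ‖c i‖) ^ N = ∏ _j : Fin N, ∑ i, ‖c i‖ := by
          rw [Finset.prod_const, Finset.card_univ, Fintype.card_fin]
      _ = ∑ k : Fin N → ι, ∏ j, ‖c (k j)‖ := by
          rw [Finset.prod_univ_sum]
          simp only [Fintype.piFinset_univ]
  rw [form_eq_sum m hΨ, hexp, Finset.mul_sum]
  refine (norm_sum_le _ _).trans (Finset.sum_le_sum fun k _ => ?_)
  rw [norm_mul, Complex.norm_conj, norm_prod, mul_comm]
  refine mul_le_mul_of_nonneg_right ?_ (Finset.prod_nonneg fun j _ => norm_nonneg _)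
  exact Finset.single_le_sum (f := fun k : Fin N → ι =>
    ‖∫ X in cellN N L, (∏ j, conj (cellWave L (m (k j)) (X j) / (Real.sqrt (L ^ 3) : ℂ))) * Ψ X‖)
    (fun k _ => norm_nonneg _) (Finset.mem_univ k)



end HusimiConcentration

end Summit.AtomisticToContinuum.BoseEinsteinCondensation.Theorems

end
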